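import Summits.QuantumFields.QCD.Theses.HeatSlicedQuarks
import Summits.QuantumFields.QCD.Theorems.HeatSlicedQuarksTracedQuadraticParametrixDerivativeColumnIdentificationAuxB
import Summits.QuantumFields.QCD.Theorems.HeatSlicedQuarksTracedQuadraticParametrixInteriorTracedAssemblyAux
import Summits.QuantumFields.QCD.Theorems.HeatSlicedQuarksTracedQuadraticParametrixMaximalRegularity

/-!
# Stub `stub_derivativeColumnIdentification` of line `Sketch` (crux `TracedQuadraticParametrix`, item stmt-QuantumFields-17985)

**The derivative column law** (the line's one new analytic estimate; lead prover-line-stmt-QuantumFields-17985-0).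
In a gauge `W` with the linear link-deficit profile `3 − Re tr W(z,μ) ≤ C_A (d(x,z)+1)² δ²` centred at `x` (`δ = ε/r²`)
and global `(ε/r²)²`-smallness of the plaquettes (`ε ≤ ε₀`), the Wilson–Dirac operator applied to the correction column at
the centre gains the parabolic derivative factor, uniformly in `0 ≤ 2s ≤ r²`:

  `‖D_W(W) (K_W(s) − K_1(s)) e_{(x,a,α)}‖₂ ≤ C (ε/r²)/√(1+s)`,   `K_V(s) = e^{-s D_W(V)ᴴ D_W(V)}`.

## Proof (no log loss)

Column Duhamel with the interacting kernel on the left (landed `stub_duhamelEntrywise`; `H_W − H_1 = D_Wᴴ E + Eᴴ D_1`,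
`E = D_W − D_1`):
`D_W Δ(s) e = −∫₀ˢ D K(s−τ) Dᴴ [E K_1(τ) e] dτ − ∫₀ˢ D K(s−τ) [Eᴴ D_1 K_1(τ) e] dτ`.
* Second vertex: `‖D K(σ′)‖ ≤ 9√2/√(1+162eσ′)` (`deriv_smoothing`) against `‖EᴴD_1K_1(τ)e‖₂ ≤ δA₁/(1+τ)` (landed
  `stub_hoppingColumnBounds`), and the `ℓ¹ → ℓ²` size `‖DK(σ′)e_q‖₂ ≤ √(C₉/(eσ′³))` (`deriv_col_sup`: spectral gain + the closed
  crux 8871) against `‖EᴴD_1K_1(τ)e‖₁ ≤ δA₂` (`hopping_col_l1_bound`) on the early half (`second_vertex_norm_le`).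
* First vertex, early half: `‖DK(σ′)Dᴴ‖ ≤ 162/(1+81eσ′)` (`deriv_adjoint_smoothing`) against `‖EK_1(τ)e‖₂ ≤ δA₁/√(1+τ)`
  (`first_vertex_early_norm_le`).
* First vertex, late half — the only configuration with two Dirac factors on one short kernel: parabolic MAXIMAL
  REGULARITY (landed `stub_maximalRegularity`, p136288) freezes `E K_1(τ) e` at `τ = s`, paying only the time-Lipschitz
  modulus `hopping_col_lipschitz` (landed free time-derivative profile p136346 inside).
-/

noncomputable section

namespace Summit.QuantumFields.QCD.Cruxes.TracedQuadraticParametrix.Sketch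

open Literature.MathematicalPhysics.QuantumLattice Literature.MathematicalPhysics.QuantumFieldTheory
  Literature.Probability.LatticeModels
open Summit.QuantumFields.QCD.Theses.HeatSlicedQuarks
open Summit.QuantumFields.QCD.Cruxes.InterleavedHeatSliceFlow.Sketch
open Summit.QuantumFields.QCD.Theorems.SmallFieldUltracontractivity.Negative
open Summit.QuantumFields.QCD.Cruxes.SmallFieldUltracontractivity.PointCentredAxialParabolic
open MeasureTheory intervalIntegral
open scoped Matrix ComplexConjugate

set_option maxHeartbeats 4000000 in
/-- **Stub `stub_derivativeColumnIdentification`** (L; lead) of line `Sketch`: the derivative column law, see the module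
docstring. -/
theorem stub_derivativeColumnIdentification :
    ∀ C_A : ℝ, 0 ≤ C_A → ∃ ε₀ : ℝ, 0 < ε₀ ∧ ∃ C : ℝ, ∀ (L : ℕ) [NeZero L]
      (W : GaugeConfig 4 L (SU3)) (m : ℝ), m ∈ Set.Icc (-(1 / 2 : ℝ)) 1 →
      ∀ (r : ℕ), 1 ≤ r → r ≤ L → ∀ (ε : ℝ), 0 < ε → ε ≤ ε₀ →
      (∀ (y : TorusSite 4 L) (μ ν : Fin 4),
        3 - ((fundamentalRep (Fin 3)) (plaquetteHolonomy W y μ ν)).trace.re ≤ (ε / (r : ℝ) ^ 2) ^ 2) →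
      ∀ (x : TorusSite 4 L),
      (∀ (z : TorusSite 4 L) (μ : Fin 4),
        3 - ((fundamentalRep (Fin 3)) (W (z, μ))).trace.re ≤
          C_A * ((torusDist x z : ℝ) + 1) ^ 2 * (ε / (r : ℝ) ^ 2) ^ 2) →
      ∀ (s : ℝ), 0 ≤ s → 2 * s ≤ (r : ℝ) ^ 2 → ∀ (a : Fin 3) (α : Fin 4),
        Real.sqrt (∑ q, ‖(wilsonDirac (fundamentalRep (Fin 3)) W m 1 *
            (NormedSpace.exp (-(s : ℂ) • ((wilsonDirac (fundamentalRep (Fin 3)) W m 1)ᴴ *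
                wilsonDirac (fundamentalRep (Fin 3)) W m 1)) -
              NormedSpace.exp (-(s : ℂ) •
                ((wilsonDirac (fundamentalRep (Fin 3))
                    (freeCfg L) m 1)ᴴ *
                  wilsonDirac (fundamentalRep (Fin 3))
                    (freeCfg L) m 1)))) q (x, a, α)‖ ^ 2) ≤
          C * (ε / (r : ℝ) ^ 2) / Real.sqrt (1 + s) := by
  intro C_A hCA
  obtain ⟨A₁, hA₁0, hHC⟩ := stub_hoppingColumnBounds C_A hCA
  obtain ⟨A₂, hA₂0, hL1⟩ := hopping_col_l1_bound hCA
  obtain ⟨A₃, hA₃0, hLIP⟩ := hopping_col_lipschitz hCA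
  obtain ⟨ε₈, hε₈, C₉, hC₉0, hSUP⟩ := deriv_col_sup
  set Qc : ℝ := Real.sqrt (8 * C₉ / Real.exp 1) with hQc
  have hQc0 : 0 ≤ Qc := Real.sqrt_nonneg _
  refine ⟨min ε₈ 1, lt_min hε₈ one_pos, 324 * A₁ + (2 * A₁ + 2 * A₃) + (80 * A₁ + Qc * A₂), ?_⟩
  intro L _ W m hm r hr hrL ε hε hεle hsmall x hprof s hs0 hsr a α
  -- notation
  set D : Matrix (TorusSite 4 L × Fin 3 × Fin 4) (TorusSite 4 L × Fin 3 × Fin 4) ℂ :=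
    wilsonDirac (fundamentalRep (Fin 3)) W m 1 with hD
  set D₁ : Matrix (TorusSite 4 L × Fin 3 × Fin 4) (TorusSite 4 L × Fin 3 × Fin 4) ℂ :=
    wilsonDirac (fundamentalRep (Fin 3)) (freeCfg L) m 1 with hD₁
  set p₀ : TorusSite 4 L × Fin 3 × Fin 4 := (x, a, α) with hp₀
  set δ : ℝ := ε / (r : ℝ) ^ 2 with hδ
  have hr0 : (0 : ℝ) < (r : ℝ) := by exact_mod_cast (Nat.lt_of_lt_of_le Nat.zero_lt_one hr)
  have hr2 : (0 : ℝ) < (r : ℝ) ^ 2 := by positivity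
  have hδ0 : 0 ≤ δ := div_nonneg hε.le hr2.le
  have hεε₈ : ε ≤ ε₈ := hεle.trans (min_le_left _ _)
  have hrL' : (r : ℝ) ≤ (L : ℝ) := by exact_mod_cast hrL
  have hsL : s ≤ (L : ℝ) ^ 2 := by nlinarith
  have hs1 : 0 < Real.sqrt (1 + s) := Real.sqrt_pos.mpr (by linarith)
  -- the kernels as functions of time
  let K : ℝ → Matrix _ _ ℂ := fun σ => NormedSpace.exp (-(σ : ℂ) • (Dᴴ * D))
  let K₁ : ℝ → Matrix _ _ ℂ := fun τ => NormedSpace.exp (-(τ : ℂ) • (D₁ᴴ * D₁))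
  let col : ℝ → (TorusSite 4 L × Fin 3 × Fin 4) → ℂ := fun τ q => K₁ τ q p₀
  /- ───── 1. the vertex bounds (landed packages) ───── -/
  have hprof' : ∀ (z : TorusSite 4 L) (μ : Fin 4),
      3 - ((fundamentalRep (Fin 3)) (W (z, μ))).trace.re ≤ C_A * ((torusDist x z : ℝ) + 1) ^ 2 * δ ^ 2 :=
    fun z μ => by rw [hδ]; exact hprof z μ
  have hE1 : ∀ τ, 0 ≤ τ → τ ≤ s →
      Real.sqrt (∑ q, ‖((D - D₁).mulVec (col τ)) q‖ ^ 2) ≤ δ * A₁ / Real.sqrt (1 + τ) :=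
    fun τ hτ0 hτs => (hHC L W m hm x δ hδ0 hprof' τ hτ0 (hτs.trans hsL) a α).1
  have hE2 : ∀ τ, 0 ≤ τ → τ ≤ s →
      Real.sqrt (∑ q, ‖((D - D₁)ᴴ.mulVec (D₁.mulVec (col τ))) q‖ ^ 2) ≤ δ * A₁ / (1 + τ) :=
    fun τ hτ0 hτs => (hHC L W m hm x δ hδ0 hprof' τ hτ0 (hτs.trans hsL) a α).2
  have hE3 : ∀ τ, 0 ≤ τ → τ ≤ s → ∑ q, ‖((D - D₁)ᴴ.mulVec (D₁.mulVec (col τ))) q‖ ≤ δ * A₂ :=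
    fun τ hτ0 hτs => hL1 L W m hm x δ hδ0 hprof' τ hτ0 (hτs.trans hsL) a α
  have hLip : ∀ u ∈ Set.Icc (s / 2) s,
      Real.sqrt (∑ q, ‖((D - D₁).mulVec (col u)) q - ((D - D₁).mulVec (col s)) q‖ ^ 2) ≤
        δ * A₃ / ((1 + s / 2) * Real.sqrt (1 + s / 2)) * (s - u) :=
    fun u hu => hLIP L W m hm x δ hδ0 hprof' s hs0 hsL a α u hu
  have hcolsup : ∀ σ, 1 ≤ σ → σ ≤ (r : ℝ) ^ 2 → ∀ q,
      Real.sqrt (∑ i, ‖(D * K σ) i q‖ ^ 2) ≤ Real.sqrt (C₉ / (Real.exp 1 * σ ^ 3)) :=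
    fun σ h1 h2 q => hSUP L W m hm r hr hrL ε hε hεε₈ hsmall σ h1 h2 q
  /- ───── 3. the Duhamel integrand with `D` applied, and its two vertices ───── -/
  let F₁ : ℝ → (TorusSite 4 L × Fin 3 × Fin 4) → ℂ := fun τ q =>
    -(((D * K (s - τ) * Dᴴ).mulVec ((D - D₁).mulVec (col τ))) q)
  let F₂ : ℝ → (TorusSite 4 L × Fin 3 × Fin 4) → ℂ := fun τ q =>
    -(((D * K (s - τ)).mulVec ((D - D₁)ᴴ.mulVec (D₁.mulVec (col τ)))) q)
  let F : ℝ → (TorusSite 4 L × Fin 3 × Fin 4) → ℂ := fun τ q =>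
    -((D * (K (s - τ) * (Dᴴ * D - D₁ᴴ * D₁) * K₁ τ)) q p₀)
  have hF₁eq : ∀ τ q, F₁ τ q = -((D * (K (s - τ) * (Dᴴ * (D - D₁)) * K₁ τ)) q p₀) := by
    intro τ q
    have hM : D * (K (s - τ) * (Dᴴ * (D - D₁)) * K₁ τ) = (D * K (s - τ) * Dᴴ) * ((D - D₁) * K₁ τ) := by
      simp only [Matrix.mul_assoc]
    rw [hM, mul_apply_eq_mulVec]
    show -(((D * K (s - τ) * Dᴴ).mulVec ((D - D₁).mulVec (col τ))) q) = _
    congr 3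
  have hF₂eq : ∀ τ q, F₂ τ q = -((D * (K (s - τ) * ((D - D₁)ᴴ * D₁) * K₁ τ)) q p₀) := by
    intro τ q
    have hM : D * (K (s - τ) * ((D - D₁)ᴴ * D₁) * K₁ τ) = (D * K (s - τ)) * ((D - D₁)ᴴ * (D₁ * K₁ τ)) := by
      simp only [Matrix.mul_assoc]
    rw [hM, mul_apply_eq_mulVec]
    show -(((D * K (s - τ)).mulVec ((D - D₁)ᴴ.mulVec (D₁.mulVec (col τ)))) q) = _
    congr 3
  have hFrepr : ∀ τ q, F τ q = F₁ τ q + F₂ τ q := by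
    intro τ q
    rw [hF₁eq, hF₂eq]
    show -((D * (K (s - τ) * (Dᴴ * D - D₁ᴴ * D₁) * K₁ τ)) q p₀) = _
    rw [conjTranspose_mul_self_sub_eq, Matrix.mul_add, Matrix.add_mul, Matrix.mul_add, Matrix.add_apply, neg_add]
  -- the column with `D` applied is the Duhamel integral of `F`
  have hduh0 : ∀ q, (K s q p₀ - K₁ s q p₀) =
      ∫ τ in (0:ℝ)..s, -((K (s - τ) * (Dᴴ * D - D₁ᴴ * D₁) * K₁ τ) q p₀) := by
    intro q
    have h := stub_duhamelEntrywise _ (Dᴴ * D) (D₁ᴴ * D₁) s q p₀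
    rw [← intervalIntegral.integral_neg] at h
    rw [← Matrix.sub_apply]
    exact h
  have hcont0 : ∀ q, ContinuousOn (fun τ => (K (s - τ) * (Dᴴ * D - D₁ᴴ * D₁) * K₁ τ) q p₀) (Set.Icc 0 s) := by
    intro q
    have h := rowDuhamel_continuousOn_entry (Dᴴ * D) (D₁ᴴ * D₁) (1 : Matrix _ _ ℂ) s
      (θ := fun _ => (1 : ℝ)) (θ' := fun _ => (0 : ℝ)) (S := Set.Icc 0 s) continuousOn_const continuousOn_const q p₀
    refine h.congr fun τ _ => ?_
    show (NormedSpace.exp (-((s - τ : ℝ) : ℂ) • (Dᴴ * D)) * (Dᴴ * D - D₁ᴴ * D₁) *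
        NormedSpace.exp (-(τ : ℂ) • (D₁ᴴ * D₁))) q p₀ = _
    simp only [Matrix.mul_one, Matrix.one_mul, Complex.ofReal_one, Complex.ofReal_zero, one_smul, zero_smul,
      add_zero]
  have hduh : ∀ q, (D * (K s - K₁ s)) q p₀ = ∫ τ in (0:ℝ)..s, F τ q := by
    intro q
    rw [Matrix.mul_apply]
    simp_rw [Matrix.sub_apply, hduh0, ← intervalIntegral.integral_const_mul]
    rw [← intervalIntegral.integral_finsetSum]
    · refine intervalIntegral.integral_congr fun τ _ => ?_
      show ∑ q', D q q' * -((K (s - τ) * (Dᴴ * D - D₁ᴴ * D₁) * K₁ τ) q' p₀) =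
        -((D * (K (s - τ) * (Dᴴ * D - D₁ᴴ * D₁) * K₁ τ)) q p₀)
      rw [Matrix.mul_apply (M := D), ← Finset.sum_neg_distrib]
      refine Finset.sum_congr rfl fun q' _ => ?_
      ring
    · intro q' _
      exact ((continuousOn_const.mul (hcont0 q').neg)).intervalIntegrable_of_Icc hs0
  -- continuity of the two vertices in `τ`
  have hcontM : ∀ (Mm : Matrix (TorusSite 4 L × Fin 3 × Fin 4) (TorusSite 4 L × Fin 3 × Fin 4) ℂ) (q : _),
      ContinuousOn (fun τ => (D * (K (s - τ) * Mm * K₁ τ)) q p₀) (Set.Icc 0 s) := by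
    intro Mm q
    have h := rowDuhamel_continuousOn_entry (Dᴴ * D) (D₁ᴴ * D₁) Mm s
      (θ := fun _ => (0 : ℝ)) (θ' := fun _ => (1 : ℝ)) (S := Set.Icc 0 s) continuousOn_const continuousOn_const
    have h' : ∀ q', ContinuousOn (fun τ => (K (s - τ) * Mm * K₁ τ) q' p₀) (Set.Icc 0 s) := by
      intro q'
      refine (h q' p₀).congr fun τ _ => ?_
      show (NormedSpace.exp (-((s - τ : ℝ) : ℂ) • (Dᴴ * D)) * Mm * NormedSpace.exp (-(τ : ℂ) • (D₁ᴴ * D₁))) q' p₀ = _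
      simp only [Complex.ofReal_one, Complex.ofReal_zero, one_smul, zero_smul, zero_add]
    have heq : (fun τ => (D * (K (s - τ) * Mm * K₁ τ)) q p₀) =
        fun τ => ∑ q', D q q' * (K (s - τ) * Mm * K₁ τ) q' p₀ := by
      funext τ; rw [Matrix.mul_apply]
    rw [heq]
    exact continuousOn_finsetSum _ fun q' _ => continuousOn_const.mul (h' q')
  have hF₁cont : ∀ q, ContinuousOn (fun τ => F₁ τ q) (Set.Icc 0 s) := fun q => by
    simp only [hF₁eq]; exact (hcontM _ q).neg
  have hF₂cont : ∀ q, ContinuousOn (fun τ => F₂ τ q) (Set.Icc 0 s) := fun q => by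
    simp only [hF₂eq]; exact (hcontM _ q).neg
  have hFint : ∀ (G : ℝ → (TorusSite 4 L × Fin 3 × Fin 4) → ℂ), (∀ q, ContinuousOn (fun τ => G τ q) (Set.Icc 0 s)) →
      ∀ q (a' b' : ℝ), 0 ≤ a' → a' ≤ b' → b' ≤ s → IntervalIntegrable (fun τ => G τ q) volume a' b' := by
    intro G hG q a' b' ha hab hb
    exact ((hG q).mono (Set.uIcc_subset_Icc ⟨ha, hab.trans hb⟩ ⟨ha.trans hab, hb⟩)).intervalIntegrable
  /- ───── 4. pointwise bounds of the second vertex ───── -/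
  have hpt2a : ∀ τ, 0 ≤ τ → τ ≤ s → Real.sqrt (∑ q, ‖F₂ τ q‖ ^ 2) ≤
      9 * Real.sqrt 2 / Real.sqrt (1 + 162 * Real.exp 1 * (s - τ)) * (δ * A₁ / (1 + τ)) := by
    intro τ hτ0 hτs
    have hστ : 0 ≤ s - τ := by linarith
    have hnorm : ∑ q, ‖F₂ τ q‖ ^ 2 = ∑ q, ‖((D * K (s - τ)).mulVec ((D - D₁)ᴴ.mulVec (D₁.mulVec (col τ)))) q‖ ^ 2 := by
      refine Finset.sum_congr rfl fun q _ => ?_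
      show ‖-(((D * K (s - τ)).mulVec ((D - D₁)ᴴ.mulVec (D₁.mulVec (col τ)))) q)‖ ^ 2 = _
      rw [norm_neg]
    rw [hnorm]
    refine (deriv_smoothing W hm hστ _).trans ?_
    exact mul_le_mul_of_nonneg_left (hE2 τ hτ0 hτs) (by positivity)
  have hpt2b : 2 ≤ s → ∀ τ, 0 ≤ τ → τ ≤ s / 2 →
      Real.sqrt (∑ q, ‖F₂ τ q‖ ^ 2) ≤ Qc * (δ * A₂) / (s * Real.sqrt s) := by
    intro hs2 τ hτ0 hτs
    have hτs' : τ ≤ s := by linarith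
    have hnorm : ∑ q, ‖F₂ τ q‖ ^ 2 = ∑ q, ‖((D * K (s - τ)).mulVec ((D - D₁)ᴴ.mulVec (D₁.mulVec (col τ)))) q‖ ^ 2 := by
      refine Finset.sum_congr rfl fun q _ => ?_
      show ‖-(((D * K (s - τ)).mulVec ((D - D₁)ᴴ.mulVec (D₁.mulVec (col τ)))) q)‖ ^ 2 = _
      rw [norm_neg]
    rw [hnorm]
    have hsr' : (r : ℝ) ^ 2 ≥ 2 * s := hsr
    have hS := hcolsup (s - τ) (by linarith) (by linarith)
    have hsqpos : 0 ≤ Real.sqrt (C₉ / (Real.exp 1 * (s - τ) ^ 3)) := Real.sqrt_nonneg _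
    calc Real.sqrt (∑ q, ‖((D * K (s - τ)).mulVec ((D - D₁)ᴴ.mulVec (D₁.mulVec (col τ)))) q‖ ^ 2)
        ≤ Real.sqrt (C₉ / (Real.exp 1 * (s - τ) ^ 3)) * ∑ q, ‖((D - D₁)ᴴ.mulVec (D₁.mulVec (col τ))) q‖ :=
          sqrt_sum_norm_sq_mulVec_le_of_col_le _ hS _
      _ ≤ Real.sqrt (C₉ / (Real.exp 1 * (s - τ) ^ 3)) * (δ * A₂) := mul_le_mul_of_nonneg_left (hE3 τ hτ0 hτs') hsqpos
      _ ≤ Real.sqrt (8 * C₉ / Real.exp 1) / (s * Real.sqrt s) * (δ * A₂) := by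
          refine mul_le_mul_of_nonneg_right ?_ (by positivity)
          have hspos : 0 < s := by linarith
          have hss : 0 < s * Real.sqrt s := by positivity
          -- `C₉/(e (s-τ)³) ≤ 8 C₉/(e s³)` since `s - τ ≥ s/2`
          have hle : C₉ / (Real.exp 1 * (s - τ) ^ 3) ≤ 8 * C₉ / Real.exp 1 / (s * Real.sqrt s) ^ 2 := by
            have hsq : (s * Real.sqrt s) ^ 2 = s ^ 3 := by
              rw [mul_pow, Real.sq_sqrt hspos.le]; ring
            rw [hsq, div_div, div_le_div_iff₀ (mul_pos (Real.exp_pos 1) (pow_pos (by linarith) 3)) (by positivity)]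
            have h8 : s ^ 3 ≤ 8 * (s - τ) ^ 3 := by
              have h' := pow_le_pow_left₀ (by linarith : 0 ≤ s / 2) (by linarith : s / 2 ≤ s - τ) 3
              ring_nf at h'
              nlinarith [h']
            have := mul_le_mul_of_nonneg_left h8 (by positivity : 0 ≤ C₉ * Real.exp 1)
            nlinarith [this]
          calc Real.sqrt (C₉ / (Real.exp 1 * (s - τ) ^ 3)) ≤ Real.sqrt (8 * C₉ / Real.exp 1 / (s * Real.sqrt s) ^ 2) :=
                Real.sqrt_le_sqrt hle
            _ = Real.sqrt (8 * C₉ / Real.exp 1) / (s * Real.sqrt s) := by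
                rw [Real.sqrt_div' _ (sq_nonneg _), Real.sqrt_sq hss.le]
      _ = Qc * (δ * A₂) / (s * Real.sqrt s) := by rw [hQc]; ring
  /- ───── 5. the second vertex integrated ───── -/
  have hv₂ := second_vertex_norm_le (fun q => ∫ τ in (0:ℝ)..s, F₂ τ q) F₂ hs0 (by positivity : 0 ≤ δ * A₁)
    (by positivity : 0 ≤ Qc * (δ * A₂)) (fun q => rfl) hF₂cont hpt2a hpt2b
  /- ───── 6. the first vertex: early half ───── -/
  have hpt1 : ∀ τ, 0 ≤ τ → τ ≤ s / 2 → Real.sqrt (∑ q, ‖F₁ τ q‖ ^ 2) ≤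
      162 / (1 + 81 * Real.exp 1 * (s - τ)) * (δ * A₁ / Real.sqrt (1 + τ)) := by
    intro τ hτ0 hτs
    have hστ : 0 ≤ s - τ := by linarith
    have hnorm : ∑ q, ‖F₁ τ q‖ ^ 2 = ∑ q, ‖((D * K (s - τ) * Dᴴ).mulVec ((D - D₁).mulVec (col τ))) q‖ ^ 2 := by
      refine Finset.sum_congr rfl fun q _ => ?_
      show ‖-(((D * K (s - τ) * Dᴴ).mulVec ((D - D₁).mulVec (col τ))) q)‖ ^ 2 = _
      rw [norm_neg]
    rw [hnorm]
    refine (deriv_adjoint_smoothing W hm hστ _).trans ?_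
    exact mul_le_mul_of_nonneg_left (hE1 τ hτ0 (by linarith)) (by positivity)
  have hv₁e := first_vertex_early_norm_le (fun q => ∫ τ in (0:ℝ)..(s / 2), F₁ τ q) F₁ hs0 (by positivity : 0 ≤ δ * A₁)
    (fun q => rfl) (fun q => (hF₁cont q).mono (Set.Icc_subset_Icc le_rfl (by linarith))) hpt1
  /- ───── 7. the first vertex: late half, frozen at `τ = s` (maximal regularity) ───── -/
  have hv₁l : Real.sqrt (∑ q, ‖∫ τ in (s / 2)..s, F₁ τ q‖ ^ 2) ≤ (2 * A₁ + 2 * A₃) * δ / Real.sqrt (1 + s) := by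
    rcases eq_or_lt_of_le hs0 with hszero | hspos
    · -- `s = 0`: the integral vanishes
      have h0 : ∀ q, (∫ τ in (s / 2)..s, F₁ τ q) = 0 := fun q => by
        rw [← hszero]; simp
      simp only [h0, norm_zero, ne_eq, OfNat.ofNat_ne_zero, not_false_eq_true, zero_pow, Finset.sum_const_zero,
        Real.sqrt_zero]
      positivity
    · have hab : s / 2 < s := by linarith
      -- the frozen curve `f(u) = E K₁(u) e`
      have hMR := stub_maximalRegularity (TorusSite 4 L × Fin 3 × Fin 4) D (s / 2) s hab
        (fun u => (D - D₁).mulVec (col u)) (δ * A₃ / ((1 + s / 2) * Real.sqrt (1 + s / 2))) (by positivity)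
        (fun j => by
          have hc : ContinuousOn (fun u => col u) (Set.Icc (s / 2) s) := by
            refine continuousOn_pi.2 fun q => ?_
            have h := rowDuhamel_continuousOn_entry (0 : Matrix _ _ ℂ) (D₁ᴴ * D₁) 1 s
              (θ := fun _ => (0 : ℝ)) (θ' := fun _ => (1 : ℝ)) (S := Set.Icc (s / 2) s)
              continuousOn_const continuousOn_const q p₀
            refine h.congr fun τ _ => ?_
            show (NormedSpace.exp (-(τ : ℂ) • (D₁ᴴ * D₁))) q p₀ = _
            simp only [smul_zero, NormedSpace.exp_zero, Matrix.one_mul, Matrix.mul_one, Complex.ofReal_one, one_smul,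
              Complex.ofReal_zero, zero_smul, zero_add]
          have hlin : Continuous fun v : (TorusSite 4 L × Fin 3 × Fin 4) → ℂ => ((D - D₁).mulVec v) j :=
            (continuous_apply j).comp (Matrix.mulVecLin (D - D₁)).continuous_of_finiteDimensional
          exact hlin.comp_continuousOn hc)
        hLip
      -- identify the integrand with `-F₁`
      have hint : ∀ i, (∫ u in (s / 2)..s,
          ((D * NormedSpace.exp (-((s - u : ℝ) : ℂ) • (Dᴴ * D)) * Dᴴ).mulVec ((D - D₁).mulVec (col u))) i) =
            -∫ τ in (s / 2)..s, F₁ τ i := by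
        intro i
        rw [← intervalIntegral.integral_neg]
        refine intervalIntegral.integral_congr fun τ _ => ?_
        show _ = -(-(((D * K (s - τ) * Dᴴ).mulVec ((D - D₁).mulVec (col τ))) i))
        rw [neg_neg]
      simp only [hint, norm_neg] at hMR
      refine hMR.trans ?_
      -- `2‖f(s)‖ + Λ(s/2)/e ≤ (2A₁ + A₃) δ/√(1+s)`
      have hfs := hE1 s hs0 le_rfl
      have hA : 0 < 1 + s / 2 := by linarith
      have hsq2 : 0 < Real.sqrt (1 + s / 2) := Real.sqrt_pos.mpr hA
      have he1 : 1 ≤ Real.exp 1 := Real.one_le_exp one_pos.le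
      have hterm2 : δ * A₃ / ((1 + s / 2) * Real.sqrt (1 + s / 2)) * (s - s / 2) / Real.exp 1 ≤
          2 * A₃ * δ / Real.sqrt (1 + s) := by
        have hfrac : (s - s / 2) / (1 + s / 2) ≤ 1 := by rw [div_le_one hA]; linarith
        have h2 := inv_sqrt_one_add_half_le hs0
        have hsqrt2 : Real.sqrt 2 ≤ 2 := by
          rw [show (2:ℝ) = Real.sqrt 4 by rw [show (4:ℝ) = 2 ^ 2 by norm_num, Real.sqrt_sq (by norm_num)]]
          exact Real.sqrt_le_sqrt (by norm_num)
        have hkey : δ * A₃ / ((1 + s / 2) * Real.sqrt (1 + s / 2)) * (s - s / 2) =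
            (δ * A₃) * ((s - s / 2) / (1 + s / 2)) * (1 / Real.sqrt (1 + s / 2)) := by
          have h1 : (1 + s / 2) ≠ 0 := hA.ne'
          have h2 : Real.sqrt (1 + s / 2) ≠ 0 := hsq2.ne'
          field_simp
        have hY0 : 0 ≤ (δ * A₃) * ((s - s / 2) / (1 + s / 2)) * (1 / Real.sqrt (1 + s / 2)) := by positivity
        rw [hkey]
        calc (δ * A₃) * ((s - s / 2) / (1 + s / 2)) * (1 / Real.sqrt (1 + s / 2)) / Real.exp 1
            ≤ (δ * A₃) * ((s - s / 2) / (1 + s / 2)) * (1 / Real.sqrt (1 + s / 2)) := div_le_self hY0 he1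
          _ ≤ (δ * A₃) * 1 * (Real.sqrt 2 / Real.sqrt (1 + s)) :=
              mul_le_mul (mul_le_mul_of_nonneg_left hfrac (by positivity)) h2 (by positivity) (by positivity)
          _ ≤ (δ * A₃) * 1 * (2 / Real.sqrt (1 + s)) := by gcongr
          _ = 2 * A₃ * δ / Real.sqrt (1 + s) := by ring
      have hterm1 : 2 * Real.sqrt (∑ j, ‖((D - D₁).mulVec (col s)) j‖ ^ 2) ≤ 2 * A₁ * δ / Real.sqrt (1 + s) := by
        calc 2 * Real.sqrt (∑ j, ‖((D - D₁).mulVec (col s)) j‖ ^ 2) ≤ 2 * (δ * A₁ / Real.sqrt (1 + s)) :=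
              mul_le_mul_of_nonneg_left hfs (by norm_num)
          _ = 2 * A₁ * δ / Real.sqrt (1 + s) := by ring
      calc 2 * Real.sqrt (∑ j, ‖((D - D₁).mulVec (col s)) j‖ ^ 2) +
            δ * A₃ / ((1 + s / 2) * Real.sqrt (1 + s / 2)) * (s - s / 2) / Real.exp 1
          ≤ 2 * A₁ * δ / Real.sqrt (1 + s) + 2 * A₃ * δ / Real.sqrt (1 + s) := add_le_add hterm1 hterm2
        _ = (2 * A₁ + 2 * A₃) * δ / Real.sqrt (1 + s) := by ring
  /- ───── 8. assembly ───── -/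
  have hsplit : ∀ q, (D * (K s - K₁ s)) q p₀ =
      ((∫ τ in (0:ℝ)..(s / 2), F₁ τ q) + ∫ τ in (s / 2)..s, F₁ τ q) + ∫ τ in (0:ℝ)..s, F₂ τ q := by
    intro q
    rw [hduh q]
    have hs4 : 0 ≤ s / 2 := by linarith
    rw [intervalIntegral.integral_add_adjacent_intervals (hFint F₁ hF₁cont q 0 (s / 2) le_rfl hs4 (by linarith))
      (hFint F₁ hF₁cont q (s / 2) s hs4 (by linarith) le_rfl), ← intervalIntegral.integral_add
      (hFint F₁ hF₁cont q 0 s le_rfl hs0 le_rfl) (hFint F₂ hF₂cont q 0 s le_rfl hs0 le_rfl)]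
    exact intervalIntegral.integral_congr fun τ _ => hFrepr τ q
  have hfinal : Real.sqrt (∑ q, ‖(D * (K s - K₁ s)) q p₀‖ ^ 2) ≤
      (324 * A₁ + (2 * A₁ + 2 * A₃) + (80 * A₁ + Qc * A₂)) * δ / Real.sqrt (1 + s) := by
    have hsum : Real.sqrt (∑ q, ‖(D * (K s - K₁ s)) q p₀‖ ^ 2) ≤
        (Real.sqrt (∑ q, ‖∫ τ in (0:ℝ)..(s / 2), F₁ τ q‖ ^ 2) + Real.sqrt (∑ q, ‖∫ τ in (s / 2)..s, F₁ τ q‖ ^ 2)) +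
          Real.sqrt (∑ q, ‖∫ τ in (0:ℝ)..s, F₂ τ q‖ ^ 2) := by
      simp only [hsplit]
      exact (sqrt_sum_norm_sq_add_le _ _).trans (add_le_add (sqrt_sum_norm_sq_add_le _ _) le_rfl)
    refine hsum.trans ?_
    have h3 : Real.sqrt (∑ q, ‖∫ τ in (0:ℝ)..s, F₂ τ q‖ ^ 2) ≤ (80 * A₁ + Qc * A₂) * δ / Real.sqrt (1 + s) := by
      refine hv₂.trans (le_of_eq ?_); ring
    have h1 : Real.sqrt (∑ q, ‖∫ τ in (0:ℝ)..(s / 2), F₁ τ q‖ ^ 2) ≤ 324 * A₁ * δ / Real.sqrt (1 + s) := by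
      refine hv₁e.trans (le_of_eq ?_); ring
    refine (add_le_add (add_le_add h1 hv₁l) h3).trans (le_of_eq ?_)
    ring
  exact hfinal

end Summit.QuantumFields.QCD.Cruxes.TracedQuadraticParametrix.Sketch

end
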